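import Mathlib
import Summits.Ventures.PercRepro2.Defs
import Summits.Ventures.PercRepro2.Graph
import Summits.Ventures.PercRepro2.OneColourSwitch
import Summits.Ventures.PercRepro2.RegionHubSign
import Summits.Ventures.PercRepro2.SideSwitch
import Summits.Ventures.PercRepro2.M9NoPocketDefs
import Summits.Ventures.PercRepro2.M9PocketRSEdgeTransfer
import Summits.Ventures.PercRepro2.M9PocketRootOnlyTransfer
import Summits.Ventures.PercRepro2.M9PocketRootOnlyPTransfer

/-!
# A cluster hanging from `{r, s, p}` — the worlds (blind cell PercRepro2, p3 g41, 2026-08-29;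
`proofs/P3-POCKETRK.md` §10⁵ (j))

Continuation of `M9PocketRootOnlyPTransfer`: when `p` is joined to `r`, `s` neither off `F`
nor in the `F`-graph, a `Y`-path from `r` or `s` never passes through `p`, so a path of `G`
from `r` is a restricted path, an `F`-path, or one of each glued at `s` (`reach_of_conn_r`); a
`Y`-path from `r` or `s` to a vertex off `L` gives a restricted path
(`conn_restrict_of_conn_mark_p`); hence the worlds off `L` are those of `G − F`
(`mem_K2_restrict_iff_of_notMem_p`) and the worlds on `L` are those of the `F`-graph alone
(`mem_K2_F_iff_of_mem_p`).  Own work; std axioms.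
-/

namespace Summit.Ventures.PercRepro2

namespace NoPocket

open Finset Classical OneColourSwitch SideSwitch

variable {V : Type*} {E : Type*} {ends : E → Sym2 V} {p q r s d : V} {ω : Config E} {L : Set V}

section WorldsP

/-- **Reach from `r`**: a `Y`-path of `G` from `r` to `x` is a restricted path, an `F`-path, or
one of each glued at `s` — when `p` is joined to `r`, `s` in neither graph (then no path passes
through `p`). -/
lemma reach_of_conn_r
    (hL : ∀ e x y, ends e = s(x, y) → x ∈ L → y ∈ L ∨ y = r ∨ y = s ∨ y = p)
    (hr : r ∉ L) (hs : s ∉ L)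
    (h1 : ¬ Conn (fun e : {e // e ∉ within ends (L ∪ {r, s, p} : Set V)} => ends e.1)
      (fun e => ω e.1) r p)
    (h2 : ¬ Conn (fun e : {e // e ∉ within ends (L ∪ {r, s, p} : Set V)} => ends e.1)
      (fun e => ω e.1) s p)
    (h3 : ¬ Conn (fun e : {e // ¬ (e ∉ within ends (L ∪ {r, s, p} : Set V))} => ends e.1)
      (fun e => ω e.1) r p)
    (h4 : ¬ Conn (fun e : {e // ¬ (e ∉ within ends (L ∪ {r, s, p} : Set V))} => ends e.1)
      (fun e => ω e.1) s p)
    {x : V} (h : Conn ends ω r x) :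
    Conn (fun e : {e // e ∉ within ends (L ∪ {r, s, p} : Set V)} => ends e.1) (fun e => ω e.1)
      r x ∨
    Conn (fun e : {e // ¬ (e ∉ within ends (L ∪ {r, s, p} : Set V))} => ends e.1)
      (fun e => ω e.1) r x ∨
    (Conn (fun e : {e // ¬ (e ∉ within ends (L ∪ {r, s, p} : Set V))} => ends e.1)
      (fun e => ω e.1) r s ∧
      Conn (fun e : {e // e ∉ within ends (L ∪ {r, s, p} : Set V)} => ends e.1)
        (fun e => ω e.1) s x) ∨
    (Conn (fun e : {e // e ∉ within ends (L ∪ {r, s, p} : Set V)} => ends e.1) (fun e => ω e.1)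
      r s ∧
      Conn (fun e : {e // ¬ (e ∉ within ends (L ∪ {r, s, p} : Set V))} => ends e.1)
        (fun e => ω e.1) s x) := by
  refine mem_of_conn_of_closed (S := {z |
    Conn (fun e : {e // e ∉ within ends (L ∪ {r, s, p} : Set V)} => ends e.1) (fun e => ω e.1)
      r z ∨
    Conn (fun e : {e // ¬ (e ∉ within ends (L ∪ {r, s, p} : Set V))} => ends e.1)
      (fun e => ω e.1) r z ∨
    (Conn (fun e : {e // ¬ (e ∉ within ends (L ∪ {r, s, p} : Set V))} => ends e.1)
      (fun e => ω e.1) r s ∧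
      Conn (fun e : {e // e ∉ within ends (L ∪ {r, s, p} : Set V)} => ends e.1)
        (fun e => ω e.1) s z) ∨
    (Conn (fun e : {e // e ∉ within ends (L ∪ {r, s, p} : Set V)} => ends e.1) (fun e => ω e.1)
      r s ∧
      Conn (fun e : {e // ¬ (e ∉ within ends (L ∪ {r, s, p} : Set V))} => ends e.1)
        (fun e => ω e.1) s z)}) ?_ (Or.inl (conn_refl _ _ _)) h
  intro a ha b hab
  simp only [Set.mem_setOf_eq] at ha ⊢
  obtain ⟨_, e, he, hends⟩ := openGraph_adj.1 hab
  by_cases hP : e ∈ within ends (L ∪ {r, s, p} : Set V)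
  · -- an edge of the `F`-graph
    have hadj : Conn (fun e : {e // ¬ (e ∉ within ends (L ∪ {r, s, p} : Set V))} => ends e.1)
        (fun e => ω e.1) a b :=
      conn_of_openAdj ⟨⟨e, not_not.2 hP⟩, he, hends⟩
    rcases ha with ha | ha | ⟨hrs, ha⟩ | ⟨hrs, ha⟩
    · have haL : a ∉ L := notMem_L_of_conn_restrict_p hL hr ha
      obtain ⟨ha', _⟩ := mem_of_mem_within hP hends
      simp only [Set.mem_union, Set.mem_insert_iff, Set.mem_singleton_iff] at ha'
      rcases ha' with ha' | rfl | rfl | rfl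
      · exact (haL ha').elim
      · exact Or.inr (Or.inl hadj)
      · exact Or.inr (Or.inr (Or.inr ⟨ha, hadj⟩))
      · exact (h1 ha).elim
    · exact Or.inr (Or.inl (conn_trans ha hadj))
    · have haL : a ∉ L := notMem_L_of_conn_restrict_p hL hs ha
      obtain ⟨ha', _⟩ := mem_of_mem_within hP hends
      simp only [Set.mem_union, Set.mem_insert_iff, Set.mem_singleton_iff] at ha'
      rcases ha' with ha' | rfl | rfl | rfl
      · exact (haL ha').elim
      · exact Or.inr (Or.inl hadj)
      · exact Or.inr (Or.inl (conn_trans hrs hadj))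
      · exact (h2 ha).elim
    · exact Or.inr (Or.inr (Or.inr ⟨hrs, conn_trans ha hadj⟩))
  · -- an edge off `F`
    have hadj : Conn (fun e : {e // e ∉ within ends (L ∪ {r, s, p} : Set V)} => ends e.1)
        (fun e => ω e.1) a b :=
      conn_of_openAdj ⟨⟨e, hP⟩, he, hends⟩
    have haL : a ∉ L := (notMem_L_of_notMem_within_p hL hP hends).1
    rcases ha with ha | ha | ⟨hrs, ha⟩ | ⟨hrs, ha⟩
    · exact Or.inl (conn_trans ha hadj)
    · have ha' := mem_of_conn_F_p (by simp) ha
      simp only [Set.mem_union, Set.mem_insert_iff, Set.mem_singleton_iff] at ha'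
      rcases ha' with ha' | rfl | rfl | rfl
      · exact (haL ha').elim
      · exact Or.inl hadj
      · exact Or.inr (Or.inr (Or.inl ⟨ha, hadj⟩))
      · exact (h3 ha).elim
    · exact Or.inr (Or.inr (Or.inl ⟨hrs, conn_trans ha hadj⟩))
    · have ha' := mem_of_conn_F_p (by simp) ha
      simp only [Set.mem_union, Set.mem_insert_iff, Set.mem_singleton_iff] at ha'
      rcases ha' with ha' | rfl | rfl | rfl
      · exact (haL ha').elim
      · exact Or.inl hadj
      · exact Or.inl (conn_trans hrs hadj)
      · exact (h4 ha).elim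

/-- **A `Y`-path from `r` or `s` to a vertex off `L` gives a restricted path from `r` or `s`**
(admissible `F`, `p` not joined to `r`, `s` off `F`). -/
lemma conn_restrict_of_conn_mark_p
    (hL : ∀ e x y, ends e = s(x, y) → x ∈ L → y ∈ L ∨ y = r ∨ y = s ∨ y = p)
    (hr : r ∉ L) (hs : s ∉ L)
    (h1 : ¬ Conn (fun e : {e // e ∉ within ends (L ∪ {r, s, p} : Set V)} => ends e.1)
      (fun e => ω e.1) r p)
    (h2 : ¬ Conn (fun e : {e // e ∉ within ends (L ∪ {r, s, p} : Set V)} => ends e.1)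
      (fun e => ω e.1) s p)
    (h3 : ¬ Conn (fun e : {e // ¬ (e ∉ within ends (L ∪ {r, s, p} : Set V))} => ends e.1)
      (fun e => ω e.1) r p)
    (h4 : ¬ Conn (fun e : {e // ¬ (e ∉ within ends (L ∪ {r, s, p} : Set V))} => ends e.1)
      (fun e => ω e.1) s p)
    {t x : V} (ht : t = r ∨ t = s) (hx : x ∉ L) (h : Conn ends ω t x) :
    Conn (fun e : {e // e ∉ within ends (L ∪ {r, s, p} : Set V)} => ends e.1) (fun e => ω e.1)
      r x ∨
    Conn (fun e : {e // e ∉ within ends (L ∪ {r, s, p} : Set V)} => ends e.1) (fun e => ω e.1)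
      s x := by
  -- an `F`-path from `r` or `s` to a vertex off `L` ends at `r` or `s`
  have hF : ∀ t', (t' = r ∨ t' = s) → ∀ {z : V}, z ∉ L →
      Conn (fun e : {e // ¬ (e ∉ within ends (L ∪ {r, s, p} : Set V))} => ends e.1)
        (fun e => ω e.1) t' z → z = r ∨ z = s := by
    intro t' ht' z hz hc
    have hz' := mem_of_conn_F_p (by rcases ht' with rfl | rfl <;> simp) hc
    simp only [Set.mem_union, Set.mem_insert_iff, Set.mem_singleton_iff] at hz'
    rcases hz' with hz' | rfl | rfl | rfl
    · exact (hz hz').elim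
    · exact Or.inl rfl
    · exact Or.inr rfl
    · exact (ht'.elim (fun e => h3 (e ▸ hc)) (fun e => h4 (e ▸ hc))).elim
  have key : x ∈ {z |
      Conn (fun e : {e // e ∉ within ends (L ∪ {r, s, p} : Set V)} => ends e.1) (fun e => ω e.1)
        r z ∨
      Conn (fun e : {e // e ∉ within ends (L ∪ {r, s, p} : Set V)} => ends e.1) (fun e => ω e.1)
        s z ∨
      Conn (fun e : {e // ¬ (e ∉ within ends (L ∪ {r, s, p} : Set V))} => ends e.1)
        (fun e => ω e.1) r z ∨
      Conn (fun e : {e // ¬ (e ∉ within ends (L ∪ {r, s, p} : Set V))} => ends e.1)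
        (fun e => ω e.1) s z} := by
    refine mem_of_conn_of_closed ?_ ?_ h
    · intro a ha b hab
      simp only [Set.mem_setOf_eq] at ha ⊢
      obtain ⟨_, e, he, hends⟩ := openGraph_adj.1 hab
      by_cases hP : e ∈ within ends (L ∪ {r, s, p} : Set V)
      · have hadj : Conn (fun e : {e // ¬ (e ∉ within ends (L ∪ {r, s, p} : Set V))} =>
            ends e.1) (fun e => ω e.1) a b :=
          conn_of_openAdj ⟨⟨e, not_not.2 hP⟩, he, hends⟩
        obtain ⟨ha', _⟩ := mem_of_mem_within hP hends
        simp only [Set.mem_union, Set.mem_insert_iff, Set.mem_singleton_iff] at ha'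
        rcases ha with ha | ha | ha | ha
        · rcases ha' with ha' | rfl | rfl | rfl
          · exact ((notMem_L_of_conn_restrict_p hL hr ha) ha').elim
          · exact Or.inr (Or.inr (Or.inl hadj))
          · exact Or.inr (Or.inr (Or.inr hadj))
          · exact (h1 ha).elim
        · rcases ha' with ha' | rfl | rfl | rfl
          · exact ((notMem_L_of_conn_restrict_p hL hs ha) ha').elim
          · exact Or.inr (Or.inr (Or.inl hadj))
          · exact Or.inr (Or.inr (Or.inr hadj))
          · exact (h2 ha).elim
        · exact Or.inr (Or.inr (Or.inl (conn_trans ha hadj)))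
        · exact Or.inr (Or.inr (Or.inr (conn_trans ha hadj)))
      · have hadj : Conn (fun e : {e // e ∉ within ends (L ∪ {r, s, p} : Set V)} => ends e.1)
            (fun e => ω e.1) a b :=
          conn_of_openAdj ⟨⟨e, hP⟩, he, hends⟩
        have haL : a ∉ L := (notMem_L_of_notMem_within_p hL hP hends).1
        rcases ha with ha | ha | ha | ha
        · exact Or.inl (conn_trans ha hadj)
        · exact Or.inr (Or.inl (conn_trans ha hadj))
        · rcases hF r (Or.inl rfl) haL ha with rfl | rfl
          · exact Or.inl hadj
          · exact Or.inr (Or.inl hadj)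
        · rcases hF s (Or.inr rfl) haL ha with rfl | rfl
          · exact Or.inl hadj
          · exact Or.inr (Or.inl hadj)
    · simp only [Set.mem_setOf_eq]
      rcases ht with rfl | rfl
      · exact Or.inl (conn_refl _ _ _)
      · exact Or.inr (Or.inl (conn_refl _ _ _))
  simp only [Set.mem_setOf_eq] at key
  rcases key with h' | h' | h' | h'
  · exact Or.inl h'
  · exact Or.inr h'
  · rcases hF r (Or.inl rfl) hx h' with rfl | rfl
    · exact Or.inl (conn_refl _ _ _)
    · exact Or.inr (conn_refl _ _ _)
  · rcases hF s (Or.inr rfl) hx h' with rfl | rfl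
    · exact Or.inl (conn_refl _ _ _)
    · exact Or.inr (conn_refl _ _ _)

/-- **Off `L`, the `Y`-world of `{r, s}` is that of the restriction** (admissible `F`, `p` not
joined to `r`, `s` off `F`). -/
lemma mem_K2_restrict_iff_of_notMem_p
    (hL : ∀ e x y, ends e = s(x, y) → x ∈ L → y ∈ L ∨ y = r ∨ y = s ∨ y = p)
    (hr : r ∉ L) (hs : s ∉ L)
    (h1 : ¬ Conn (fun e : {e // e ∉ within ends (L ∪ {r, s, p} : Set V)} => ends e.1)
      (fun e => ω e.1) r p)
    (h2 : ¬ Conn (fun e : {e // e ∉ within ends (L ∪ {r, s, p} : Set V)} => ends e.1)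
      (fun e => ω e.1) s p)
    (h3 : ¬ Conn (fun e : {e // ¬ (e ∉ within ends (L ∪ {r, s, p} : Set V))} => ends e.1)
      (fun e => ω e.1) r p)
    (h4 : ¬ Conn (fun e : {e // ¬ (e ∉ within ends (L ∪ {r, s, p} : Set V))} => ends e.1)
      (fun e => ω e.1) s p)
    {x : V} (hx : x ∉ L) :
    x ∈ K2 ends r s ω ↔
      x ∈ K2 (fun e : {e // e ∉ within ends (L ∪ {r, s, p} : Set V)} => ends e.1) r s
        (fun e => ω e.1) := by
  rw [mem_K2_iff, mem_K2_iff]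
  constructor
  · rintro (h | h)
    · exact conn_restrict_of_conn_mark_p hL hr hs h1 h2 h3 h4 (Or.inl rfl) hx h
    · exact conn_restrict_of_conn_mark_p hL hr hs h1 h2 h3 h4 (Or.inr rfl) hx h
  · rintro (h | h)
    · exact Or.inl (conn_of_conn_restrict h)
    · exact Or.inr (conn_of_conn_restrict h)

/-- **On `L`, the `Y`-world of `{r, s}` is that of the `F`-graph alone**, when `p` is not
`Y`-joined to `r`, `s` in `G`. -/
lemma mem_K2_F_iff_of_mem_p
    (hL : ∀ e x y, ends e = s(x, y) → x ∈ L → y ∈ L ∨ y = r ∨ y = s ∨ y = p)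
    (hr : r ∉ L) (hs : s ∉ L) (hpr : ¬ Conn ends ω r p) (hps : ¬ Conn ends ω s p)
    {x : V} (hx : x ∈ L) :
    x ∈ K2 ends r s ω ↔
      x ∈ K2 (fun e : {e // ¬ (e ∉ within ends (L ∪ {r, s, p} : Set V))} => ends e.1) r s
        (fun e => ω e.1) := by
  rw [mem_K2_iff, mem_K2_iff]
  constructor
  · intro h
    have hmem : x ∈ {z | (Conn ends ω r z ∨ Conn ends ω s z) ∧ (z ∈ L →
        Conn (fun e : {e // ¬ (e ∉ within ends (L ∪ {r, s, p} : Set V))} => ends e.1)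
          (fun e => ω e.1) r z ∨
        Conn (fun e : {e // ¬ (e ∉ within ends (L ∪ {r, s, p} : Set V))} => ends e.1)
          (fun e => ω e.1) s z)} := by
      have hstart : ∀ t, (t = r ∨ t = s) → Conn ends ω t x → x ∈ {z |
          (Conn ends ω r z ∨ Conn ends ω s z) ∧ (z ∈ L →
          Conn (fun e : {e // ¬ (e ∉ within ends (L ∪ {r, s, p} : Set V))} => ends e.1)
            (fun e => ω e.1) r z ∨
          Conn (fun e : {e // ¬ (e ∉ within ends (L ∪ {r, s, p} : Set V))} => ends e.1)
            (fun e => ω e.1) s z)} := by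
        intro t ht hc
        refine mem_of_conn_of_closed ?_ ?_ hc
        · intro a ha b hab
          simp only [Set.mem_setOf_eq] at ha ⊢
          obtain ⟨hreach, haL⟩ := ha
          obtain ⟨_, e, he, hends⟩ := openGraph_adj.1 hab
          have hreach' : Conn ends ω r b ∨ Conn ends ω s b :=
            hreach.imp (fun h' => conn_trans h' (conn_of_openAdj ⟨e, he, hends⟩))
              (fun h' => conn_trans h' (conn_of_openAdj ⟨e, he, hends⟩))
          refine ⟨hreach', fun hb => ?_⟩
          have hF : e ∈ within ends (L ∪ {r, s, p} : Set V) :=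
            mem_within_of_mem_L_p hL (by rw [hends, Sym2.eq_swap]) hb
          have hadj : Conn (fun e : {e // ¬ (e ∉ within ends (L ∪ {r, s, p} : Set V))} =>
              ends e.1) (fun e => ω e.1) a b :=
            conn_of_openAdj ⟨⟨e, not_not.2 hF⟩, he, hends⟩
          rcases hL e b a (by rw [hends, Sym2.eq_swap]) hb with haL' | rfl | rfl | rfl
          · rcases haL haL' with h' | h'
            · exact Or.inl (conn_trans h' hadj)
            · exact Or.inr (conn_trans h' hadj)
          · exact Or.inl hadj
          · exact Or.inr hadj
          · exact (hreach.elim hpr hps).elim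
        · simp only [Set.mem_setOf_eq]
          refine ⟨?_, fun htL => ?_⟩
          · rcases ht with rfl | rfl
            · exact Or.inl (conn_refl _ _ _)
            · exact Or.inr (conn_refl _ _ _)
          · rcases ht with rfl | rfl
            · exact (hr htL).elim
            · exact (hs htL).elim
      rcases h with h | h
      · exact hstart r (Or.inl rfl) h
      · exact hstart s (Or.inr rfl) h
    simp only [Set.mem_setOf_eq] at hmem
    exact hmem.2 hx
  · rintro (h | h)
    · exact Or.inl (conn_of_conn_restrict h)
    · exact Or.inr (conn_of_conn_restrict h)

end WorldsP

end NoPocket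

end Summit.Ventures.PercRepro2
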